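import Summits.NavierStokesRegularity.NavierStokesRegularity.Theorems.CoriolisHeadTypeIRateTransport
import Summits.NavierStokesRegularity.NavierStokesRegularity.Theorems.CoriolisHeadFarFieldLimitTools
import HarnessLib

/-!
# CoriolisHeadTypeIRateReduction — crux `NoCoRotatingCore` (stmt-NavierStokesRegularity-22676), line
# `far_field_constancy` v2 (skeleton 15c9a82ad206abb9), stub K1c `stub_typeIRate` — file 2/2: K1c REDUCED to a
# power decay of the pressure gradient

* §3 **`norm_mul_norm_le_of_transport_linear`** (bootstrap): for `W ∈ C¹` bounded by `m`, `0 ≤ κ ≤ aR/2`, if beyond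
  `R` the transport expression obeys `‖DW·(ay − By) + aW + BW‖ ≤ κ‖W‖/‖y‖ + D₀/‖y‖² + C/‖y‖^{1+δ}` — a LINEAR term
  with the integrable coefficient `κ/‖y‖` plus integrable forcing — then `‖y‖‖W(y)‖ ≤ 2(Rm + D₀/(aR) + C/(aδR^δ))`
  beyond `R` (maximise `‖z‖‖W(z)‖` over the shell, feed the maximum into file 1/2's transport estimate, absorb);
  `…_shift`: the same along spirals centred at any `c`.
* §4 **`transport_form_of_rotated`**: for a rotated Leray profile and `ac − Bc = −b`,
  `DU·(a(y − c) − B(y − c)) + a(U − b) + B(U − b) = νΔU − DU·(U − b) − (∇P + ab + Bb)` — the constant drift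
  `(b·∇)U` is absorbed by shifting the centre (the role of the landed translation covariance P1).
  **`typeIRate_of_gradient_pressure_decay`**: a bounded smooth rotated profile with K1a-decay whose pressure
  gradient tends to `g = −(ab + Bb)` at a POWER rate `‖∇P(y) − g‖ ≤ C/‖y‖^{1+δ}` satisfies the Type-I rate
  `‖U(y) − b‖ ≤ K/(1 + ‖y‖)` — i.e. K1c's conclusion.  Inputs by name: file 1/2, and from
  `CoriolisHeadFarFieldLimitTools.lean` `FarFieldLimit.exists_radius_decay` (K1a(1): `‖DU‖ ≤ 1/r`, `‖D²U‖ ≤ 1/r²`),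
  `FarFieldLimit.exists_add_clm_apply_eq_of_skew`, tree `gradient_pressure_eq_of_rotated`,
  `norm_laplacian_le_three_mul_norm_iteratedFDeriv_two`.

HONEST FRAMING.  This is the TRANSPORT HALF of K1c: with K1a, `νΔU = O(r⁻²)` and the coefficient `‖DU‖ = O(r⁻¹)`
of the only linear term are integrable along `r = e^{as}`, so the pressure-gradient RATE is the one load-bearing
input; K1a + K1b give `∇P → g` with NO rate (`Theorems/CoriolisHeadFarFieldLimit*.lean`), and an `O(1/r)` rate
would lose the logarithm.  What is MISSING for K1c is exactly the power gain `‖∇P − g‖ = O(r^{−1−δ})` (it needs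
`‖DU‖ ≲ r^{−1−δ'}` at scale `r`, while `νΔ` acts at scale `1` — the line card's «angular regularity» caveat).
K1c, K1a, `NoCoRotatingCore`, Pineau–Vicol's Conjecture 1.1 and Navier–Stokes regularity stay OPEN.

References: line card `Cruxes/NoCoRotatingCore/Lines/far_field_constancy.md`; B. Pineau, V. Vicol, arXiv:2607.09619
(2026), (1.8), Prop. 3.1 [PineauVicol2026]; H. Jia, V. Šverák, Invent. Math. 196 (2014) §4 [JiaSverak2014].
-/

noncomputable section

open Set Function Filter Topology Metric InnerProductSpace Real

-- the summit and its single sub-problem share the name (CONVENTIONS §1), as in every Theorems file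
set_option linter.dupNamespace false

namespace Summit.NavierStokesRegularity.NavierStokesRegularity.Theorems.CoriolisHead

namespace TypeIRate

open Literature.Analysis.FluidPDE
open scoped RealInnerProductSpace

/-! ## §3 Absorbing a linear term with an integrable coefficient: the Type-I rate by a bootstrap -/

/-- **Type-I rate from the transport structure.**  Let `a > 0`, `B` skew, `W ∈ C¹(ℝ³; ℝ³)` bounded
(`‖W‖ ≤ m`), `R > 0`, `0 ≤ κ ≤ aR/2`, and suppose that beyond `R` the transport expression obeys
`‖DW·(ay − By) + aW + BW‖ ≤ κ‖W(y)‖/‖y‖ + D₀/‖y‖² + C/‖y‖^{1+δ}` (a LINEAR term with the integrable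
coefficient `κ/‖y‖`, plus integrable forcing).  Then `‖y‖‖W(y)‖ ≤ 2(Rm + D₀/(aR) + C/(aδR^δ))` beyond `R`.
Proof: on the shell `R ≤ ‖z‖ ≤ ‖y‖` the continuous function `‖z‖‖W(z)‖` attains its maximum `Q`; there the
linear term is `≤ κQ/‖z‖²`, so `norm_mul_norm_le_of_transport` gives `Q ≤ Rm + (κQ + D₀)/(aR) + C/(aδR^δ)`,
and `κ/(aR) ≤ ½` absorbs. [folklore] -/
theorem norm_mul_norm_le_of_transport_linear {a : ℝ} (ha : 0 < a)
    {B : EuclideanSpace ℝ (Fin 3) →L[ℝ] EuclideanSpace ℝ (Fin 3)} (hB : ∀ x, inner ℝ (B x) x = 0)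
    {W : EuclideanSpace ℝ (Fin 3) → EuclideanSpace ℝ (Fin 3)} (hW : Differentiable ℝ W)
    {R κ D₀ C δ m : ℝ} (hR : 0 < R) (hδ : 0 < δ) (hκ : 0 ≤ κ) (hκR : κ ≤ a * R / 2) (hD₀ : 0 ≤ D₀)
    (hC : 0 ≤ C) (hm : ∀ y : EuclideanSpace ℝ (Fin 3), ‖W y‖ ≤ m)
    (hG : ∀ y : EuclideanSpace ℝ (Fin 3), R ≤ ‖y‖ →
      ‖fderiv ℝ W y (a • y - B y) + (a • W y + B (W y))‖ ≤
        κ * ‖W y‖ / ‖y‖ + D₀ / ‖y‖ ^ 2 + C / ‖y‖ ^ (1 + δ))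
    (y : EuclideanSpace ℝ (Fin 3)) (hy : R ≤ ‖y‖) :
    ‖y‖ * ‖W y‖ ≤ 2 * (R * m + D₀ / (a * R) + C / (a * δ * R ^ δ)) := by
  -- the shell `R ≤ ‖z‖ ≤ ‖y‖` and the maximum of `‖z‖ ‖W z‖` on it
  set S : Set (EuclideanSpace ℝ (Fin 3)) := {z | R ≤ ‖z‖ ∧ ‖z‖ ≤ ‖y‖} with hS
  have hSc : IsCompact S := by
    refine (isCompact_closedBall (0 : EuclideanSpace ℝ (Fin 3)) ‖y‖).of_isClosed_subset ?_ ?_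
    · exact (isClosed_le continuous_const continuous_norm).inter
        (isClosed_le continuous_norm continuous_const)
    · intro z hz
      exact mem_closedBall_zero_iff.2 hz.2
  have hyS : y ∈ S := ⟨hy, le_rfl⟩
  have hfc : Continuous fun z : EuclideanSpace ℝ (Fin 3) => ‖z‖ * ‖W z‖ :=
    continuous_norm.mul hW.continuous.norm
  obtain ⟨z₀, hz₀S, hmax⟩ := hSc.exists_isMaxOn ⟨y, hyS⟩ hfc.continuousOn
  set Q : ℝ := ‖z₀‖ * ‖W z₀‖ with hQ
  have hQ0 : 0 ≤ Q := by positivity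
  have hQmax : ∀ z ∈ S, ‖z‖ * ‖W z‖ ≤ Q := fun z hz => hmax hz
  -- on the shell the linear term is a `1/‖z‖²` forcing
  have hG' : ∀ z : EuclideanSpace ℝ (Fin 3), R ≤ ‖z‖ → ‖z‖ ≤ ‖y‖ →
      ‖fderiv ℝ W z (a • z - B z) + (a • W z + B (W z))‖ ≤
        (κ * Q + D₀) / ‖z‖ ^ 2 + C / ‖z‖ ^ (1 + δ) := by
    intro z hz1 hz2
    have hzpos : 0 < ‖z‖ := hR.trans_le hz1
    have h1 : κ * ‖W z‖ / ‖z‖ ≤ κ * Q / ‖z‖ ^ 2 := by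
      rw [div_le_div_iff₀ hzpos (pow_pos hzpos 2)]
      have h := mul_le_mul_of_nonneg_left (hQmax z ⟨hz1, hz2⟩) hκ
      nlinarith
    calc ‖fderiv ℝ W z (a • z - B z) + (a • W z + B (W z))‖
        ≤ κ * ‖W z‖ / ‖z‖ + D₀ / ‖z‖ ^ 2 + C / ‖z‖ ^ (1 + δ) := hG z hz1
      _ ≤ κ * Q / ‖z‖ ^ 2 + D₀ / ‖z‖ ^ 2 + C / ‖z‖ ^ (1 + δ) := by linarith
      _ = (κ * Q + D₀) / ‖z‖ ^ 2 + C / ‖z‖ ^ (1 + δ) := by rw [add_div]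
  -- the transport estimate at the maximum point
  have hkey := norm_mul_norm_le_of_transport ha hB hW hR hδ (by positivity : 0 ≤ κ * Q + D₀) hC
    (fun z _ => hm z) hG' hz₀S.1 hz₀S.2
  -- absorb
  have habs : (κ * Q + D₀) / (a * R) ≤ Q / 2 + D₀ / (a * R) := by
    rw [add_div]
    have h1 : κ * Q / (a * R) ≤ Q / 2 := by
      rw [div_le_div_iff₀ (by positivity) two_pos]
      have := mul_le_mul_of_nonneg_right hκR hQ0
      nlinarith
    linarith
  have hQle : Q ≤ 2 * (R * m + D₀ / (a * R) + C / (a * δ * R ^ δ)) := by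
    have : Q ≤ R * m + (Q / 2 + D₀ / (a * R)) + C / (a * δ * R ^ δ) := by
      calc Q = ‖z₀‖ * ‖W z₀‖ := hQ
        _ ≤ R * m + (κ * Q + D₀) / (a * R) + C / (a * δ * R ^ δ) := hkey
        _ ≤ R * m + (Q / 2 + D₀ / (a * R)) + C / (a * δ * R ^ δ) := by linarith
    linarith
  exact (hQmax y hyS).trans hQle

/-- **The same with a shifted centre** `c` (spiral characteristics of the affine drift `V(y) = a(y − c) − B(y − c)`,
which is how a constant far-field drift `b = (a − B)(−c)` is absorbed): if beyond `‖y − c‖ ≥ R` one has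
`‖DW·(a(y−c) − B(y−c)) + aW + BW‖ ≤ κ‖W(y)‖/‖y−c‖ + D₀/‖y−c‖² + C/‖y−c‖^{1+δ}`, then
`‖y − c‖‖W(y)‖ ≤ 2(Rm + D₀/(aR) + C/(aδR^δ))` there. [folklore] -/
theorem norm_mul_norm_le_of_transport_linear_shift {a : ℝ} (ha : 0 < a)
    {B : EuclideanSpace ℝ (Fin 3) →L[ℝ] EuclideanSpace ℝ (Fin 3)} (hB : ∀ x, inner ℝ (B x) x = 0)
    {W : EuclideanSpace ℝ (Fin 3) → EuclideanSpace ℝ (Fin 3)} (hW : Differentiable ℝ W)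
    (c : EuclideanSpace ℝ (Fin 3))
    {R κ D₀ C δ m : ℝ} (hR : 0 < R) (hδ : 0 < δ) (hκ : 0 ≤ κ) (hκR : κ ≤ a * R / 2) (hD₀ : 0 ≤ D₀)
    (hC : 0 ≤ C) (hm : ∀ y : EuclideanSpace ℝ (Fin 3), ‖W y‖ ≤ m)
    (hG : ∀ y : EuclideanSpace ℝ (Fin 3), R ≤ ‖y - c‖ →
      ‖fderiv ℝ W y (a • (y - c) - B (y - c)) + (a • W y + B (W y))‖ ≤
        κ * ‖W y‖ / ‖y - c‖ + D₀ / ‖y - c‖ ^ 2 + C / ‖y - c‖ ^ (1 + δ))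
    (y : EuclideanSpace ℝ (Fin 3)) (hy : R ≤ ‖y - c‖) :
    ‖y - c‖ * ‖W y‖ ≤ 2 * (R * m + D₀ / (a * R) + C / (a * δ * R ^ δ)) := by
  set W' : EuclideanSpace ℝ (Fin 3) → EuclideanSpace ℝ (Fin 3) := fun z => W (z + c) with hW'
  have hW'd : Differentiable ℝ W' := hW.comp (differentiable_id.add_const c)
  have hfd : ∀ z, fderiv ℝ W' z = fderiv ℝ W (z + c) := fun z => by
    rw [hW']
    exact fderiv_comp_add_right c
  have hm' : ∀ z : EuclideanSpace ℝ (Fin 3), ‖W' z‖ ≤ m := fun z => hm (z + c)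
  have hG'' : ∀ z : EuclideanSpace ℝ (Fin 3), R ≤ ‖z‖ →
      ‖fderiv ℝ W' z (a • z - B z) + (a • W' z + B (W' z))‖ ≤
        κ * ‖W' z‖ / ‖z‖ + D₀ / ‖z‖ ^ 2 + C / ‖z‖ ^ (1 + δ) := by
    intro z hz
    have h := hG (z + c) (by rwa [add_sub_cancel_right])
    rw [add_sub_cancel_right] at h
    rw [hfd]
    exact h
  have h := norm_mul_norm_le_of_transport_linear ha hB hW'd hR hδ hκ hκR hD₀ hC hm' hG'' (y - c) hy
  simpa only [hW', sub_add_cancel] using h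

/-! ## §4 K1c REDUCED to a power decay of the pressure gradient -/

section Profile

open scoped Laplacian ContDiff

variable {ν a : ℝ} {B : EuclideanSpace ℝ (Fin 3) →L[ℝ] EuclideanSpace ℝ (Fin 3)}
  {U : EuclideanSpace ℝ (Fin 3) → EuclideanSpace ℝ (Fin 3)} {P : EuclideanSpace ℝ (Fin 3) → ℝ}

/-- **The rotated profile system in transport form around a shifted centre.**  If `a c − B c = −b` then, with
`W = U − b`, `DU(y)·(a(y − c) − B(y − c)) + aW + BW = νΔU(y) − DU(y)·(U(y) − b) − (∇P(y) + ab + Bb)`: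
the constant far-field drift `(b·∇)U` is absorbed into the spiral characteristics centred at `c`.
[cite: PineauVicol2026, (1.8a) (p. 3)] -/
theorem transport_form_of_rotated
    (heq : ∀ y, -(ν • (Δ U) y) + a • U y + a • fderiv ℝ U y y + (B (U y) - fderiv ℝ U y (B y)) +
      convect U U y + gradient P y = 0)
    {b c : EuclideanSpace ℝ (Fin 3)} (hc : a • c - B c = -b) (y : EuclideanSpace ℝ (Fin 3)) :
    fderiv ℝ (fun z => U z - b) y (a • (y - c) - B (y - c)) + (a • (U y - b) + B (U y - b)) =
      ν • (Δ U) y - fderiv ℝ U y (U y - b) - (gradient P y + (a • b + B b)) := by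
  have hD : fderiv ℝ (fun z => U z - b) y = fderiv ℝ U y := fderiv_sub_const b
  have h1 : a • (y - c) - B (y - c) = (a • y - B y) + b := by
    rw [smul_sub, map_sub, show b = -(a • c - B c) by rw [hc, neg_neg]]
    abel
  rw [hD, h1, gradient_pressure_eq_of_rotated heq y, convect_apply, map_add, map_sub,
    map_sub (fderiv ℝ U y) (U y) b, map_smul, smul_sub, map_sub B]
  abel

/-- **K1c reduced to the pressure gradient (the transport half of `stub_typeIRate`).**  For a bounded smooth
rotated profile with scale-natural derivative decay (K1a), IF the pressure gradient converges to its limit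
`g = −(ab + Bb)` at a POWER rate, `‖∇P(y) + ab + Bb‖ ≤ C/‖y‖^{1+δ}` (`δ > 0`) beyond some radius, THEN the profile
attains its far-field value at the Type-I rate: `‖U(y) − b‖ ≤ K/(1 + ‖y‖)`.  Mechanism: along the spiral
characteristics centred at `c`, `ac − Bc = −b`, the system reads `dW/ds + (a + B)W = νΔU − DU·W − (∇P − g)`
(`transport_form_of_rotated`); `νΔU = O(1/r²)` and the coefficient `‖DU‖ = O(1/r)` of the linear term are
integrable along `r = e^{as}`, so ONLY the pressure-gradient rate is load-bearing
(`norm_mul_norm_le_of_transport_linear_shift`); a merely `O(1/r)` gradient would lose a logarithm — the resonance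
named in the line card.  K1c itself (no pressure hypothesis) stays OPEN: what is missing is the power gain for
`∇P − g`. [cite: PineauVicol2026, Conj. 1.1, Prop. 3.1] -/
theorem typeIRate_of_gradient_pressure_decay (hν : 0 < ν) (ha : 0 < a)
    (hB : ∀ x, inner ℝ (B x) x = 0) (hU : ContDiff ℝ (⊤ : ℕ∞) U)
    (heq : ∀ y, -(ν • (Δ U) y) + a • U y + a • fderiv ℝ U y y + (B (U y) - fderiv ℝ U y (B y)) +
      convect U U y + gradient P y = 0)
    (hbdd : ∃ M : ℝ, ∀ y, ‖U y‖ ≤ M)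
    (hdecay : ∀ ε : ℝ, 0 < ε → ∃ R : ℝ, ∀ y : EuclideanSpace ℝ (Fin 3), R ≤ ‖y‖ →
      ‖y‖ * ‖fderiv ℝ U y‖ + ‖y‖ ^ 2 * ‖iteratedFDeriv ℝ 2 U y‖ ≤ ε)
    (b : EuclideanSpace ℝ (Fin 3))
    (hPdecay : ∃ δ C R₀ : ℝ, 0 < δ ∧ ∀ y : EuclideanSpace ℝ (Fin 3), R₀ ≤ ‖y‖ →
      ‖gradient P y + (a • b + B b)‖ ≤ C / ‖y‖ ^ (1 + δ)) :
    ∃ K : ℝ, ∀ y : EuclideanSpace ℝ (Fin 3), ‖U y - b‖ ≤ K / (1 + ‖y‖) := by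
  obtain ⟨M, hM⟩ := hbdd
  obtain ⟨δ, C, R₀, hδ, hPd⟩ := hPdecay
  have hU2 : ContDiff ℝ 2 U := hU.of_le (by norm_cast)
  have hUd : Differentiable ℝ U := hU.differentiable (by simp)
  have hWd : Differentiable ℝ (fun z => U z - b) := hUd.sub_const b
  -- the bound `m` on `W = U − b`
  obtain ⟨m, hm0, hWm⟩ : ∃ m : ℝ, 0 ≤ m ∧ ∀ z : EuclideanSpace ℝ (Fin 3), ‖U z - b‖ ≤ m :=
    ⟨M + ‖b‖, add_nonneg ((norm_nonneg _).trans (hM 0)) (norm_nonneg _),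
      fun z => (norm_sub_le _ _).trans (add_le_add (hM z) le_rfl)⟩
  -- `C ≥ 0` may be assumed (enlarge)
  have hC0 : 0 ≤ max C 0 := le_max_right _ _
  have hPd' : ∀ y : EuclideanSpace ℝ (Fin 3), R₀ ≤ ‖y‖ →
      ‖gradient P y + (a • b + B b)‖ ≤ max C 0 / ‖y‖ ^ (1 + δ) := fun y hy =>
    (hPd y hy).trans (div_le_div_of_nonneg_right (le_max_left _ _) (Real.rpow_nonneg (norm_nonneg _) _))
  -- the centre `c`: `a c − B c = −b`
  have hnegB : ∀ x, inner ℝ ((-B) x) x = 0 := fun x => by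
    simp only [FunLike.coe_neg, Pi.neg_apply, inner_neg_left, hB x, neg_zero]
  obtain ⟨c, hc⟩ := FarFieldLimit.exists_add_clm_apply_eq_of_skew hnegB ha.ne' (-b)
  have hc' : a • c - B c = -b := by
    simpa only [FunLike.coe_neg, Pi.neg_apply, ← sub_eq_add_neg] using hc
  -- K1a at level `1`
  obtain ⟨R₁, hR₁1, hR₁⟩ := FarFieldLimit.exists_radius_decay hdecay one_pos
  -- the radius
  obtain ⟨R, hR1, hRc, hRR₁, hRR₀, hRa⟩ : ∃ R : ℝ, 1 ≤ R ∧ 2 * ‖c‖ ≤ R ∧ 2 * R₁ ≤ R ∧ 2 * R₀ ≤ R ∧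
      4 / a ≤ R := by
    refine ⟨max (max (2 * ‖c‖) (2 * max R₁ R₀)) (max (4 / a) 1), ?_, ?_, ?_, ?_, ?_⟩
    · exact (le_max_right _ _).trans (le_max_right _ _)
    · exact (le_max_left _ _).trans (le_max_left _ _)
    · have h1 := le_max_left R₁ R₀
      have h2 : 2 * max R₁ R₀ ≤ max (max (2 * ‖c‖) (2 * max R₁ R₀)) (max (4 / a) 1) :=
        (le_max_right _ _).trans (le_max_left _ _)
      linarith
    · have h1 := le_max_right R₁ R₀
      have h2 : 2 * max R₁ R₀ ≤ max (max (2 * ‖c‖) (2 * max R₁ R₀)) (max (4 / a) 1) :=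
        (le_max_right _ _).trans (le_max_left _ _)
      linarith
    · exact (le_max_left _ _).trans (le_max_right _ _)
  have hRpos : 0 < R := one_pos.trans_le hR1
  -- the transport inequality beyond `R`
  have hT : ∀ y : EuclideanSpace ℝ (Fin 3), R ≤ ‖y - c‖ →
      ‖fderiv ℝ (fun z => U z - b) y (a • (y - c) - B (y - c)) + (a • (U y - b) + B (U y - b))‖ ≤
        2 * ‖U y - b‖ / ‖y - c‖ + (12 * ν) / ‖y - c‖ ^ 2 +
          (max C 0 * 2 ^ (1 + δ)) / ‖y - c‖ ^ (1 + δ) := by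
    intro y hy
    have hyc : ‖y - c‖ / 2 ≤ ‖y‖ := by
      have h1 : ‖y - c‖ ≤ ‖y‖ + ‖c‖ := norm_sub_le y c
      linarith
    have hycpos : 0 < ‖y - c‖ := hRpos.trans_le hy
    have hypos : 0 < ‖y‖ := by linarith
    have hyR₁ : R₁ ≤ ‖y‖ := by linarith
    have hyR₀ : R₀ ≤ ‖y‖ := by linarith
    obtain ⟨hD1, hD2⟩ := hR₁ y hyR₁
    rw [transport_form_of_rotated heq hc' y]
    -- three terms
    have t1 : ‖ν • (Δ U) y‖ ≤ 12 * ν / ‖y - c‖ ^ 2 := by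
      rw [norm_smul, Real.norm_of_nonneg hν.le]
      have h1 := norm_laplacian_le_three_mul_norm_iteratedFDeriv_two hU2 y
      have h3 : 1 / ‖y‖ ^ 2 ≤ 4 / ‖y - c‖ ^ 2 := by
        rw [div_le_div_iff₀ (pow_pos hypos 2) (pow_pos hycpos 2)]
        nlinarith
      have h4 : ‖(Δ U) y‖ ≤ 3 * (4 / ‖y - c‖ ^ 2) := by linarith [hD2.trans h3]
      have h5 := mul_le_mul_of_nonneg_left h4 hν.le
      have e : ν * (3 * (4 / ‖y - c‖ ^ 2)) = 12 * ν / ‖y - c‖ ^ 2 := by ring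
      linarith
    have t2 : ‖fderiv ℝ U y (U y - b)‖ ≤ 2 * ‖U y - b‖ / ‖y - c‖ := by
      have h1 : ‖fderiv ℝ U y‖ ≤ 2 / ‖y - c‖ := by
        refine hD1.trans ?_
        rw [div_le_div_iff₀ hypos hycpos]
        linarith
      have h2 := ContinuousLinearMap.le_opNorm (fderiv ℝ U y) (U y - b)
      have h3 := mul_le_mul_of_nonneg_right h1 (norm_nonneg (U y - b))
      have e : 2 / ‖y - c‖ * ‖U y - b‖ = 2 * ‖U y - b‖ / ‖y - c‖ := by ring
      linarith
    have t3 : ‖gradient P y + (a • b + B b)‖ ≤ max C 0 * 2 ^ (1 + δ) / ‖y - c‖ ^ (1 + δ) := by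
      refine (hPd' y hyR₀).trans ?_
      have hpow : (‖y - c‖ / 2) ^ (1 + δ) ≤ ‖y‖ ^ (1 + δ) :=
        Real.rpow_le_rpow (by positivity) hyc (by linarith)
      rw [Real.div_rpow (norm_nonneg _) zero_le_two] at hpow
      have h2pos : 0 < (2 : ℝ) ^ (1 + δ) := Real.rpow_pos_of_pos two_pos _
      have hycpow : 0 < ‖y - c‖ ^ (1 + δ) := Real.rpow_pos_of_pos hycpos _
      have hypow : 0 < ‖y‖ ^ (1 + δ) := Real.rpow_pos_of_pos hypos _
      rw [div_le_div_iff₀ hypow hycpow]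
      rw [div_le_iff₀ h2pos] at hpow
      nlinarith [hC0]
    have s1 := norm_sub_le (ν • (Δ U) y - fderiv ℝ U y (U y - b)) (gradient P y + (a • b + B b))
    have s2 := norm_sub_le (ν • (Δ U) y) (fderiv ℝ U y (U y - b))
    linarith
  -- the transport lemma with `κ = 2`
  have hκR : (2 : ℝ) ≤ a * R / 2 := by
    have : 4 ≤ a * R := by rwa [div_le_iff₀' ha] at hRa
    linarith
  have hrate : ∀ y : EuclideanSpace ℝ (Fin 3), R ≤ ‖y - c‖ →
      ‖y - c‖ * ‖U y - b‖ ≤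
        2 * (R * m + 12 * ν / (a * R) + max C 0 * 2 ^ (1 + δ) / (a * δ * R ^ δ)) :=
    fun y hy => norm_mul_norm_le_of_transport_linear_shift ha hB hWd c hRpos hδ zero_le_two hκR
      (by positivity : (0 : ℝ) ≤ 12 * ν) (by positivity : (0 : ℝ) ≤ max C 0 * 2 ^ (1 + δ)) hWm hT y hy
  set K₀ : ℝ := 2 * (R * m + 12 * ν / (a * R) + max C 0 * 2 ^ (1 + δ) / (a * δ * R ^ δ)) with hK₀
  have hRδ : 0 < R ^ δ := Real.rpow_pos_of_pos hRpos _
  have hK₀0 : 0 ≤ K₀ := by positivity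
  -- conversion to `K/(1 + ‖y‖)`
  refine ⟨max (K₀ * (2 + ‖c‖)) (m * (1 + R + ‖c‖)), fun y => ?_⟩
  have hypos1 : 0 < 1 + ‖y‖ := by positivity
  have hyle : ‖y‖ ≤ ‖y - c‖ + ‖c‖ := by
    have h := norm_add_le (y - c) c
    rwa [sub_add_cancel] at h
  rw [le_div_iff₀ hypos1]
  by_cases hfar : R ≤ ‖y - c‖
  · have h1 : ‖y - c‖ * ‖U y - b‖ ≤ K₀ := hrate y hfar
    have h2 : 1 + ‖y‖ ≤ ‖y - c‖ * (2 + ‖c‖) := by nlinarith [norm_nonneg c]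
    calc ‖U y - b‖ * (1 + ‖y‖) ≤ ‖U y - b‖ * (‖y - c‖ * (2 + ‖c‖)) :=
          mul_le_mul_of_nonneg_left h2 (norm_nonneg _)
      _ = (‖y - c‖ * ‖U y - b‖) * (2 + ‖c‖) := by ring
      _ ≤ K₀ * (2 + ‖c‖) := mul_le_mul_of_nonneg_right h1 (by positivity)
      _ ≤ max (K₀ * (2 + ‖c‖)) (m * (1 + R + ‖c‖)) := le_max_left _ _
  · rw [not_le] at hfar
    have h2 : 1 + ‖y‖ ≤ 1 + R + ‖c‖ := by linarith
    calc ‖U y - b‖ * (1 + ‖y‖) ≤ m * (1 + R + ‖c‖) := mul_le_mul (hWm y) h2 hypos1.le hm0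
      _ ≤ max (K₀ * (2 + ‖c‖)) (m * (1 + R + ‖c‖)) := le_max_right _ _

end Profile

end TypeIRate

end Summit.NavierStokesRegularity.NavierStokesRegularity.Theorems.CoriolisHead

end
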